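import Literature.AlgebraicGeometry.Modules.CechLocalizedSections
import Literature.AlgebraicGeometry.Modules.CechOrderedBicomplex
import HarnessLib

/-!
# The localized-sections ordered Čech complex `P̌•_ord(𝓤, F)` and its counit to `Č•_ord(𝓤, F)`
# (Görtz–Wedhorn II Def. 21.68 / Lemma 22.36; Hartshorne II Prop. 5.2, III Lemma 4.2)

Sequel of `Modules/CechLocalizedSections` (the localized-sections Čech sheaves `P̌ⁿ(𝓤, F)`, sheafification of
`V ↦ Π_α Γ(X, V ⊓ U_α) ⊗_{Γ(X, U_α)} Γ(F, U_α)`, with their counit `b ⊗ m ↦ b • m|` to the Čech sheaves) and of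
`Modules/CechOrderedComplex` (the ordered Čech complex `Č•_ord(𝓤, M)`: faces `U_s`, signs `ε(s, a)`, `∂_a`, `d`).
For a finite linearly ordered family `𝓤` this file builds the ORDERED complex of the localized-sections sheaves,
with the same combinatorics, and its comparison map to the ordered Čech complex:

* §1 **face change of pieces** `PCech.facePiece : Γ(X, V ⊓ U_s) ⊗_{Γ(X, U_s)} Γ(F, U_s) → Γ(X, V ⊓ U_t) ⊗_{Γ(X, U_t)} Γ(F, U_t)`
  for `U_t ⊆ U_s` (`b ⊗ m ↦ b| ⊗ m|`), its transitivity, compatibility with restriction in `V`, with the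
  `Γ(X, V)`-action, with functoriality in `F` and with the counit (`counitPiece_facePiece`);
* §2 the presheaf-level face maps `PCechOrd.faceMapP a : P̌ⁿ → P̌ⁿ⁺¹` (`(∂_a c)_t = ε(t, a) c_{t ∖ a}|`), the identity
  `∂_b ∂_a + ∂_a ∂_b = 0` (`faceFunP_faceFunP_add`, same signs `CechOrd.sgn_mul_sgn_erase_add`), the differential
  `PCechOrd.dP = Σ_a ∂_a`, `dP_comp_dP`, and **the presheaf-level complex `PCechOrd.precomplex U F`**
  (`CochainComplex X.PresheafOfModules ℕ`); compatibility of `dP` with the presheaf counit (`counitPresheaf_dP`) and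
  with functoriality in `F` (`presheafMap_dP`);
* §3 **`PCechOrd.complex U F := sheafification of the precomplex`** (`(modulesSheafify X).mapHomologicalComplex`), its
  terms `PCech.obj (CechOrd.faces U n) 0 F` (`complex_X`), functoriality `PCechOrd.complexMap`, and **the counit chain
  map `PCechOrd.counitComplex U F : P̌•_ord(𝓤, F) ⟶ Č•_ord(𝓤, F)`** (componentwise `PCech.counit`), natural in `F`.

Everything is PROVED (definitions with bodies + theorems); 0 named facts; no new instances. Typed for the cell
`pub-hodge-ring2` (Stage I (b) of the `D⁺_qc` comparison: with `Modules/CechLocalizedSectionsAffine`,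
`Modules/CechOrderedBicomplex` and `Modules/QuasiIsoOfAffineSections` it feeds the comparison
`Tot P̌•_ord(𝓤, I•) ⥲ Tot Č•_ord(𝓤, I•)`) — a research route conditional on HC_CM, not a corollary; nothing here refers to it.

## References

* U. Görtz, T. Wedhorn, *Algebraic Geometry II: Cohomology of Schemes*, Springer Spektrum (2023): Def. 21.64,
  Def. 21.68 (pp. 258–260), Lemma 22.36 (p. 349). [GortzWedhorn2023]
* R. Hartshorne, *Algebraic Geometry*, GTM 52 (1977), II Prop. 5.2 (p. 110), III Lemma 4.2 (p. 220). [Hartshorne1977]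
* The Stacks Project, Tags 01FG (ordered Čech complex), 08D6 (coherator). [StacksProject]
-/

noncomputable section

-- `TopCat.Presheaf`/`Scheme.Modules` are not reducible (as in Mathlib's `AlgebraicGeometry/Modules/Sheaf.lean`).
set_option backward.isDefEq.respectTransparency false

universe u

open CategoryTheory CategoryTheory.Limits Opposite TopologicalSpace AlgebraicGeometry TensorProduct

namespace Literature.AlgebraicGeometry.Modules

/-! ## §1 Face change of pieces -/

namespace PCech

open CechOrd

variable {X : Scheme.{u}} {ι : Type u} [LinearOrder ι] (U : ι → X.Opens) (F : X.Modules) (V : X.Opens)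

/-- The face `U_t` of the ordered family is contained in `U_s` for `s ⊆ t`. [cite: GortzWedhorn2023, Def. 21.64 (p. 258)] -/
theorem face_faces_le {m m' : ℕ} (β : Idx ι m') (γ : Idx ι m) (h : (γ 0).1 ⊆ (β 0).1) :
    face (faces U m') β ≤ face (faces U m) γ := by
  rw [face_faces, face_faces]
  exact faceSet_anti U h

/-- The piece over the larger face `U_t ⊆ U_s` as a module over `Γ(X, U_s)` (restriction of scalars), to be bound
with `letI`. [cite: Hartshorne1977, II Prop. 5.2 (p. 110)] -/
@[reducible]
def pieceModuleFace {m m' : ℕ} (β : Idx ι m') (γ : Idx ι m) (h : (γ 0).1 ⊆ (β 0).1) :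
    Module Γ(X, face (faces U m) γ) (Piece (faces U m') 0 F V β) :=
  Module.compHom _ (Cech.resO (X := X) (face_faces_le U β γ h))

/-- **Face change of pieces** `Γ(X, V ⊓ U_s) ⊗_{Γ(X, U_s)} Γ(F, U_s) → Γ(X, V ⊓ U_t) ⊗_{Γ(X, U_t)} Γ(F, U_t)` for
`s ⊆ t` (`U_t ⊆ U_s`): `b ⊗ m ↦ b|_{V ⊓ U_t} ⊗ m|_{U_t}`. [cite: GortzWedhorn2023, Def. 21.68 (p. 260)]
[cite: Hartshorne1977, II Prop. 5.2 (p. 110)] -/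
def facePiece {m m' : ℕ} (β : Idx ι m') (γ : Idx ι m) (h : (γ 0).1 ⊆ (β 0).1) :
    Piece (faces U m) 0 F V γ →+ Piece (faces U m') 0 F V β :=
  letI := pieceModuleFace U F V β γ h
  (TensorProduct.lift
    (LinearMap.mk₂ Γ(X, face (faces U m) γ)
      (fun (b : Γ(X, V ⊓ face (faces U m) γ)) (x : Γ(F, face (faces U m) γ)) =>
        ((Cech.resO (X := X) (inf_le_inf_left V (face_faces_le U β γ h)) b ⊗ₜ[Γ(X, face (faces U m') β)]
          Cech.res F (face_faces_le U β γ h) x : Piece (faces U m') 0 F V β)))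
      (fun b b' x => by simp only [map_add, TensorProduct.add_tmul])
      (fun a b x => by
        rw [baseMod_smul_def, map_mul, Cech.resO_resO]
        change _ = Cech.resO (X := X) (face_faces_le U β γ h) a •
          ((Cech.resO (X := X) (inf_le_inf_left V (face_faces_le U β γ h)) b ⊗ₜ[Γ(X, face (faces U m') β)]
            Cech.res F (face_faces_le U β γ h) x : Piece (faces U m') 0 F V β))
        rw [TensorProduct.smul_tmul', baseMod_smul_def, Cech.resO_resO])
      (fun b x x' => by simp only [map_add, TensorProduct.tmul_add])
      (fun a b x => by
        rw [Cech.res_smul, ← TensorProduct.smul_tmul]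
        change _ = Cech.resO (X := X) (face_faces_le U β γ h) a •
          ((Cech.resO (X := X) (inf_le_inf_left V (face_faces_le U β γ h)) b ⊗ₜ[Γ(X, face (faces U m') β)]
            Cech.res F (face_faces_le U β γ h) x : Piece (faces U m') 0 F V β))
        rw [TensorProduct.smul_tmul']))).toAddMonoidHom

/-- Face change on pure tensors. [cite: GortzWedhorn2023, Def. 21.68 (p. 260)] -/
@[simp]
theorem facePiece_tmul {m m' : ℕ} (β : Idx ι m') (γ : Idx ι m) (h : (γ 0).1 ⊆ (β 0).1)
    (b : Γ(X, V ⊓ face (faces U m) γ)) (x : Γ(F, face (faces U m) γ)) :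
    facePiece U F V β γ h (tmul b x) =
      tmul (Cech.resO (X := X) (inf_le_inf_left V (face_faces_le U β γ h)) b) (Cech.res F (face_faces_le U β γ h) x) :=
  rfl

/-- Face change along equal simplices (transport). [cite: GortzWedhorn2023, Def. 21.68 (p. 260)] -/
theorem facePiece_congr {m m' : ℕ} {β β' : Idx ι m'} (e : β = β') (γ : Idx ι m) (h : (γ 0).1 ⊆ (β 0).1)
    (h' : (γ 0).1 ⊆ (β' 0).1) (y : Piece (faces U m) 0 F V γ) {m'' : ℕ} (δ : Idx ι m'')
    (hδ : (β 0).1 ⊆ (δ 0).1) (hδ' : (β' 0).1 ⊆ (δ 0).1) :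
    facePiece U F V δ β hδ (facePiece U F V β γ h y) = facePiece U F V δ β' hδ' (facePiece U F V β' γ h' y) := by
  subst e; rfl

/-- **Transitivity of face change.** [cite: GortzWedhorn2023, Def. 21.64 (p. 258)] -/
theorem facePiece_facePiece {m m' m'' : ℕ} (δ : Idx ι m'') (β : Idx ι m') (γ : Idx ι m)
    (h : (γ 0).1 ⊆ (β 0).1) (h' : (β 0).1 ⊆ (δ 0).1) (y : Piece (faces U m) 0 F V γ) :
    facePiece U F V δ β h' (facePiece U F V β γ h y) = facePiece U F V δ γ (h.trans h') y := by
  induction y using induction_on with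
  | zero => simp only [map_zero]
  | tmul b x => rw [facePiece_tmul, facePiece_tmul, facePiece_tmul, Cech.resO_resO, Cech.res_res]
  | add y z hy hz => simp only [map_add, hy, hz]

/-- Face change commutes with restriction in `V`. [cite: GortzWedhorn2023, Def. 21.68 (p. 260)] -/
theorem restrictPiece_facePiece {W : X.Opens} (hW : W ≤ V) {m m' : ℕ} (β : Idx ι m') (γ : Idx ι m)
    (h : (γ 0).1 ⊆ (β 0).1) (y : Piece (faces U m) 0 F V γ) :
    restrictPiece (faces U m') 0 F hW β (facePiece U F V β γ h y) =
      facePiece U F W β γ h (restrictPiece (faces U m) 0 F hW γ y) := by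
  induction y using induction_on with
  | zero => simp only [map_zero]
  | tmul b x => rw [facePiece_tmul, restrictPiece_tmul, restrictPiece_tmul, facePiece_tmul, Cech.resO_resO,
      Cech.resO_resO]
  | add y z hy hz => simp only [map_add, hy, hz]

/-- Face change commutes with the `Γ(X, V)`-action. [cite: GortzWedhorn2023, Def. 21.68 (p. 260)] -/
theorem facePiece_smul {m m' : ℕ} (β : Idx ι m') (γ : Idx ι m) (h : (γ 0).1 ⊆ (β 0).1) (r : Γ(X, V))
    (y : Piece (faces U m) 0 F V γ) :
    facePiece U F V β γ h (letI := pieceModule (faces U m) 0 F V γ; r • y) =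
      (letI := pieceModule (faces U m') 0 F V β; r • facePiece U F V β γ h y) := by
  letI := pieceModule (faces U m) 0 F V γ
  letI := pieceModule (faces U m') 0 F V β
  induction y using induction_on with
  | zero => simp only [smul_zero, map_zero]
  | tmul b x => rw [smul_tmul, facePiece_tmul, facePiece_tmul, smul_tmul, map_mul, Cech.resO_resO]
  | add y z hy hz => simp only [smul_add, map_add, hy, hz]

variable {F} {G : X.Modules}

/-- Face change is natural in the sheaf. [cite: GortzWedhorn2023, Def. 21.68 (p. 260)] -/
theorem mapPiece_facePiece (φ : F ⟶ G) {m m' : ℕ} (β : Idx ι m') (γ : Idx ι m) (h : (γ 0).1 ⊆ (β 0).1)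
    (y : Piece (faces U m) 0 F V γ) :
    mapPiece (faces U m') 0 φ V β (facePiece U F V β γ h y) = facePiece U G V β γ h (mapPiece (faces U m) 0 φ V γ y) := by
  induction y using induction_on with
  | zero => simp only [map_zero]
  | tmul b x => rw [facePiece_tmul, mapPiece_tmul, mapPiece_tmul, facePiece_tmul, Cech.app_res]
  | add y z hy hz => simp only [map_add, hy, hz]

variable (F)

/-- **Face change is compatible with the counit**: `counit(∂ y) = (counit y)|`. [cite: GortzWedhorn2023, Lemma 22.36 (p. 349)] -/
theorem counitPiece_facePiece {m m' : ℕ} (β : Idx ι m') (γ : Idx ι m) (h : (γ 0).1 ⊆ (β 0).1)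
    (y : Piece (faces U m) 0 F V γ) :
    counitPiece (faces U m') 0 F V β (facePiece U F V β γ h y) =
      Cech.res F (inf_le_inf_left V (face_faces_le U β γ h)) (counitPiece (faces U m) 0 F V γ y) := by
  induction y using induction_on with
  | zero => simp only [map_zero]
  | tmul b x =>
    rw [facePiece_tmul, counitPiece_tmul, counitPiece_tmul, Cech.res_smul, Cech.res_res, Cech.res_res]
  | add y z hy hz => simp only [map_add, hy, hz]

/-- Face change of the components of a cochain along equal indices (transport). [cite: GortzWedhorn2023, Def. 21.68 (p. 260)] -/
theorem facePiece_apply_congr {m m' : ℕ} (β : Idx ι m') (c : ∀ δ : Idx ι m, Piece (faces U m) 0 F V δ)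
    {δ₁ δ₂ : Idx ι m} (e : δ₁ = δ₂) (h₁ : (δ₁ 0).1 ⊆ (β 0).1) (h₂ : (δ₂ 0).1 ⊆ (β 0).1) :
    facePiece U F V β δ₁ h₁ (c δ₁) = facePiece U F V β δ₂ h₂ (c δ₂) := by
  subst e; rfl

end PCech

/-! ## §2 The presheaf-level ordered complex of localized sections -/

namespace PCechOrd

open CechOrd PCech

variable {X : Scheme.{u}} {ι : Type u} [LinearOrder ι] (U : ι → X.Opens) (F : X.Modules)

/-- Cochains of degree `n` over `V`: families of pieces indexed by the `n`-simplices. [cite: GortzWedhorn2023, Def. 21.68 (p. 260)] -/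
abbrev PSections (n : ℕ) (V : X.Opens) : Type u := PCech.Sections (faces U n) 0 F V

variable (n : ℕ)

/-- The component formula of the face map `∂_a` on localized sections: `(∂_a c)_t = ε(t, a) c_{t ∖ a}|` if `a ∈ t`,
else `0`. [cite: GortzWedhorn2023, Def. 21.68 (p. 260)] -/
def faceFunP (a : ι) (V : X.Opens) (c : PSections U F n V) : PSections U F (n + 1) V := fun β =>
  if h : a ∈ (β 0).1 then
    CechOrd.sgn (β 0).1 a • facePiece U F V β (delIdx β a h) (Finset.erase_subset a _) (c (delIdx β a h))
  else 0

/-- Components of `faceFunP` at a simplex containing `a`. [cite: GortzWedhorn2023, Def. 21.68 (p. 260)] -/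
theorem faceFunP_apply_of_mem (a : ι) (V : X.Opens) (c : PSections U F n V) (β : Idx ι (n + 1))
    (h : a ∈ (β 0).1) :
    faceFunP U F n a V c β =
      CechOrd.sgn (β 0).1 a • facePiece U F V β (delIdx β a h) (Finset.erase_subset a _) (c (delIdx β a h)) :=
  dif_pos h

/-- Components of `faceFunP` at a simplex not containing `a` vanish. [cite: GortzWedhorn2023, Def. 21.68 (p. 260)] -/
theorem faceFunP_apply_of_not_mem (a : ι) (V : X.Opens) (c : PSections U F n V) (β : Idx ι (n + 1))
    (h : a ∉ (β 0).1) : faceFunP U F n a V c β = 0 :=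
  dif_neg h

/-- `faceFunP` is additive. [cite: GortzWedhorn2023, Def. 21.68 (p. 260)] -/
theorem faceFunP_add (a : ι) (V : X.Opens) (c c' : PSections U F n V) :
    faceFunP U F n a V (c + c') = faceFunP U F n a V c + faceFunP U F n a V c' := by
  funext β
  by_cases h : a ∈ (β 0).1
  · rw [PCech.add_apply, faceFunP_apply_of_mem _ _ _ _ _ _ _ h, faceFunP_apply_of_mem _ _ _ _ _ _ _ h,
      faceFunP_apply_of_mem _ _ _ _ _ _ _ h, PCech.add_apply, map_add, smul_add]
  · rw [PCech.add_apply, faceFunP_apply_of_not_mem _ _ _ _ _ _ _ h, faceFunP_apply_of_not_mem _ _ _ _ _ _ _ h,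
      faceFunP_apply_of_not_mem _ _ _ _ _ _ _ h, add_zero]

/-- `faceFunP` of zero. [cite: GortzWedhorn2023, Def. 21.68 (p. 260)] -/
theorem faceFunP_zero (a : ι) (V : X.Opens) : faceFunP U F n a V 0 = 0 := by
  have h := faceFunP_add U F n a V 0 0
  rw [add_zero] at h
  exact left_eq_add.mp h

/-- `faceFunP` commutes with the `Γ(X, V)`-action. [cite: GortzWedhorn2023, Def. 21.68 (p. 260)] -/
theorem faceFunP_smul (a : ι) (V : X.Opens) (r : Γ(X, V)) (c : PSections U F n V) :
    faceFunP U F n a V (r • c) = r • faceFunP U F n a V c := by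
  funext β
  by_cases h : a ∈ (β 0).1
  · rw [PCech.smul_apply, faceFunP_apply_of_mem _ _ _ _ _ _ _ h, faceFunP_apply_of_mem _ _ _ _ _ _ _ h,
      PCech.smul_apply, facePiece_smul]
    letI := PCech.pieceModule (faces U (n + 1)) 0 F V β
    exact (smul_comm r (CechOrd.sgn (β 0).1 a) _).symm
  · rw [PCech.smul_apply, faceFunP_apply_of_not_mem _ _ _ _ _ _ _ h, faceFunP_apply_of_not_mem _ _ _ _ _ _ _ h]
    letI := PCech.pieceModule (faces U (n + 1)) 0 F V β
    exact (smul_zero r).symm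

/-- `faceFunP` commutes with restriction in `V`. [cite: GortzWedhorn2023, Def. 21.68 (p. 260)] -/
theorem restrict_faceFunP (a : ι) {V W : X.Opens} (hW : W ≤ V) (c : PSections U F n V) :
    PCech.restrict (faces U (n + 1)) 0 F hW (faceFunP U F n a V c) =
      faceFunP U F n a W (PCech.restrict (faces U n) 0 F hW c) := by
  funext β
  by_cases h : a ∈ (β 0).1
  · rw [PCech.restrict_apply, faceFunP_apply_of_mem _ _ _ _ _ _ _ h, faceFunP_apply_of_mem _ _ _ _ _ _ _ h,
      map_zsmul, restrictPiece_facePiece, PCech.restrict_apply]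
  · rw [PCech.restrict_apply, faceFunP_apply_of_not_mem _ _ _ _ _ _ _ h, faceFunP_apply_of_not_mem _ _ _ _ _ _ _ h,
      map_zero]

/-- **`∂_b ∂_a + ∂_a ∂_b = 0` on localized cochains**: the two ways of deleting `a ≠ b` from a simplex carry opposite
signs (`CechOrd.sgn_mul_sgn_erase_add`) and `∂_a ∂_a = 0`. [cite: GortzWedhorn2023, Def. 21.64 (p. 258), `d ∘ d = 0`] -/
theorem faceFunP_faceFunP_add (a b : ι) (V : X.Opens) (c : PSections U F n V) (γ : Idx ι (n + 2)) :
    faceFunP U F (n + 1) b V (faceFunP U F n a V c) γ + faceFunP U F (n + 1) a V (faceFunP U F n b V c) γ = 0 := by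
  by_cases hb : b ∈ (γ 0).1
  · by_cases ha : a ∈ (γ 0).1
    · by_cases hab : a = b
      · subst hab
        have hna : a ∉ (delIdx γ a ha 0).1 := by
          rw [delIdx_val]; exact Finset.notMem_erase a _
        rw [faceFunP_apply_of_mem _ _ _ _ _ _ _ ha, faceFunP_apply_of_not_mem _ _ _ _ _ _ _ hna, map_zero,
          smul_zero, add_zero]
      · have ha' : a ∈ (delIdx γ b hb 0).1 := by
          rw [delIdx_val]; exact Finset.mem_erase.mpr ⟨hab, ha⟩
        have hb' : b ∈ (delIdx γ a ha 0).1 := by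
          rw [delIdx_val]; exact Finset.mem_erase.mpr ⟨Ne.symm hab, hb⟩
        have e : delIdx (delIdx γ b hb) a ha' = delIdx (delIdx γ a ha) b hb' :=
          Idx.ext (by rw [delIdx_val, delIdx_val, delIdx_val, delIdx_val, Finset.erase_right_comm])
        rw [faceFunP_apply_of_mem _ _ _ _ _ _ _ hb, faceFunP_apply_of_mem _ _ _ _ _ _ _ ha',
          faceFunP_apply_of_mem _ _ _ _ _ _ _ ha, faceFunP_apply_of_mem _ _ _ _ _ _ _ hb',
          map_zsmul, map_zsmul, facePiece_facePiece, facePiece_facePiece, smul_smul, smul_smul,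
          facePiece_apply_congr U F V γ c e _ ((Finset.erase_subset b _).trans (Finset.erase_subset a _)),
          ← add_smul]
        change (CechOrd.sgn (γ 0).1 b * CechOrd.sgn ((γ 0).1.erase b) a +
          CechOrd.sgn (γ 0).1 a * CechOrd.sgn ((γ 0).1.erase a) b) • _ = 0
        rw [CechOrd.sgn_mul_sgn_erase_add hb ha (Ne.symm hab), zero_smul]
    · have ha' : a ∉ (delIdx γ b hb 0).1 := by
        rw [delIdx_val]; exact fun h => ha (Finset.mem_of_mem_erase h)
      rw [faceFunP_apply_of_mem _ _ _ _ _ _ _ hb, faceFunP_apply_of_not_mem _ _ _ _ _ _ _ ha',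
        faceFunP_apply_of_not_mem _ _ _ _ _ _ _ ha, map_zero, smul_zero, zero_add]
  · by_cases ha : a ∈ (γ 0).1
    · have hb' : b ∉ (delIdx γ a ha 0).1 := by
        rw [delIdx_val]; exact fun h => hb (Finset.mem_of_mem_erase h)
      rw [faceFunP_apply_of_not_mem _ _ _ _ _ _ _ hb, faceFunP_apply_of_mem _ _ _ _ _ _ _ ha,
        faceFunP_apply_of_not_mem _ _ _ _ _ _ _ hb', map_zero, smul_zero, zero_add]
    · rw [faceFunP_apply_of_not_mem _ _ _ _ _ _ _ hb, faceFunP_apply_of_not_mem _ _ _ _ _ _ _ ha, add_zero]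

variable [Fintype ι]

/-- The component formula of the differential: `(d c)_t = Σ_a (∂_a c)_t`. [cite: GortzWedhorn2023, Def. 21.68 (p. 260)] -/
def dFun (V : X.Opens) (c : PSections U F n V) : PSections U F (n + 1) V := ∑ a : ι, faceFunP U F n a V c

/-- Components of `dFun`. [cite: GortzWedhorn2023, Def. 21.68 (p. 260)] -/
theorem dFun_apply (V : X.Opens) (c : PSections U F n V) (γ : Idx ι (n + 1)) :
    dFun U F n V c γ = ∑ a : ι, faceFunP U F n a V c γ := by
  rw [dFun, Finset.sum_apply]

/-- `dFun` is additive. [cite: GortzWedhorn2023, Def. 21.68 (p. 260)] -/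
theorem dFun_add (V : X.Opens) (c c' : PSections U F n V) : dFun U F n V (c + c') = dFun U F n V c + dFun U F n V c' := by
  simp only [dFun, faceFunP_add, Finset.sum_add_distrib]

/-- `dFun` commutes with the `Γ(X, V)`-action. [cite: GortzWedhorn2023, Def. 21.68 (p. 260)] -/
theorem dFun_smul (V : X.Opens) (r : Γ(X, V)) (c : PSections U F n V) : dFun U F n V (r • c) = r • dFun U F n V c := by
  simp only [dFun, faceFunP_smul, Finset.smul_sum]

/-- `dFun` commutes with restriction. [cite: GortzWedhorn2023, Def. 21.68 (p. 260)] -/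
theorem restrict_dFun {V W : X.Opens} (hW : W ≤ V) (c : PSections U F n V) :
    PCech.restrict (faces U (n + 1)) 0 F hW (dFun U F n V c) = dFun U F n W (PCech.restrict (faces U n) 0 F hW c) := by
  simp only [dFun, map_sum, restrict_faceFunP]

/-- **`d ∘ d = 0` on localized cochains.** [cite: GortzWedhorn2023, Def. 21.64 (p. 258), `d ∘ d = 0`] -/
theorem dFun_dFun (V : X.Opens) (c : PSections U F n V) : dFun U F (n + 1) V (dFun U F n V c) = 0 := by
  funext γ
  rw [dFun_apply, PCech.zero_apply]
  have hsum : ∀ b : ι, faceFunP U F (n + 1) b V (dFun U F n V c) γ = ∑ a : ι, faceFunP U F (n + 1) b V (faceFunP U F n a V c) γ := by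
    intro b
    rw [dFun]
    induction (Finset.univ : Finset ι) using Finset.induction_on with
    | empty => rw [Finset.sum_empty, Finset.sum_empty, faceFunP_zero, PCech.zero_apply]
    | insert x t hx ih => rw [Finset.sum_insert hx, Finset.sum_insert hx, faceFunP_add, PCech.add_apply, ih]
  simp_rw [hsum]
  rw [← Finset.sum_product' (f := fun b a => faceFunP U F (n + 1) b V (faceFunP U F n a V c) γ)]
  refine Finset.sum_involution (fun p _ => p.swap) (fun p _ => ?_) (fun p _ hp he => ?_)
    (fun p _ => Finset.mem_product.mpr ⟨Finset.mem_univ _, Finset.mem_univ _⟩) (fun p _ => p.swap_swap)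
  · exact faceFunP_faceFunP_add U F n p.2 p.1 V c γ
  · apply hp
    have h1 : p.1 = p.2 := (congrArg Prod.fst he).symm
    rw [← h1]
    by_cases ha : p.1 ∈ (γ 0).1
    · have hna : p.1 ∉ (delIdx γ p.1 ha 0).1 := by
        rw [delIdx_val]; exact Finset.notMem_erase _ _
      rw [faceFunP_apply_of_mem _ _ _ _ _ _ _ ha, faceFunP_apply_of_not_mem _ _ _ _ _ _ _ hna, map_zero, smul_zero]
    · rw [faceFunP_apply_of_not_mem _ _ _ _ _ _ _ ha]

/-- **The presheaf-level differential** `d : P̌ⁿ(𝓤, F) → P̌ⁿ⁺¹(𝓤, F)` (presheaves of `𝒪_X`-modules).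
[cite: GortzWedhorn2023, Def. 21.68 (p. 260)] -/
def dP : PCech.presheafMod (faces U n) 0 F ⟶ PCech.presheafMod (faces U (n + 1)) 0 F :=
  PresheafOfModules.homMk
    { app := fun V => AddCommGrpCat.ofHom
        { toFun := fun (c : PSections U F n V.unop) => dFun U F n V.unop c
          map_zero' := by
            have h := dFun_add U F n V.unop 0 0
            rw [add_zero] at h
            exact left_eq_add.mp h
          map_add' := dFun_add U F n V.unop }
      naturality := fun {V W} i => by
        ext c
        exact (restrict_dFun U F n i.unop.le c).symm }
    (fun V r c => dFun_smul U F n V.unop r c)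

/-- Sections of `dP`. [cite: GortzWedhorn2023, Def. 21.68 (p. 260)] -/
theorem dP_app_apply (V : (X.Opens)ᵒᵖ) (c : PSections U F n V.unop) :
    (dP U F n).app V c = dFun U F n V.unop c := rfl

/-- **`d ≫ d = 0`** for the presheaf-level differential. [cite: GortzWedhorn2023, Def. 21.64 (p. 258)] -/
theorem dP_comp_dP : dP U F n ≫ dP U F (n + 1) = 0 := by
  ext V c
  exact dFun_dFun U F n V.unop c

/-- **The presheaf-level ordered complex of localized sections `P̌•_ord(𝓤, F)`.** [cite: GortzWedhorn2023, Def. 21.68 (p. 260)] -/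
def precomplex : CochainComplex X.PresheafOfModules ℕ :=
  CochainComplex.of (fun n => PCech.presheafMod (faces U n) 0 F) (fun n => dP U F n) fun n => dP_comp_dP U F n

/-- The differentials of the precomplex. [cite: GortzWedhorn2023, Def. 21.68 (p. 260)] -/
@[simp]
theorem precomplex_d : (precomplex U F).d n (n + 1) = dP U F n := by
  simp [precomplex]

/-- **The presheaf differential is compatible with the counit**: `counit ∘ d_P = d_Č ∘ counit`.
[cite: GortzWedhorn2023, Def. 21.68 (p. 260) and Lemma 22.36 (p. 349)] -/
theorem dP_counitPresheaf :
    dP U F n ≫ counitPresheaf (faces U (n + 1)) 0 F = counitPresheaf (faces U n) 0 F ≫ (CechOrd.d U F n).val := by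
  ext V c
  refine funext fun γ => ?_
  change counitPiece (faces U (n + 1)) 0 F V.unop γ (dFun U F n V.unop c γ) =
    ((CechOrd.d U F n).app V.unop (fun α => counitPiece (faces U n) 0 F V.unop α (c α)) :
      Cech.Sections (faces U (n + 1)) 0 F V.unop) γ
  rw [CechOrd.d_app_apply, dFun_apply, map_sum]
  refine Finset.sum_congr rfl fun a _ => ?_
  by_cases h : a ∈ (γ 0).1
  · rw [faceFunP_apply_of_mem _ _ _ _ _ _ _ h, CechOrd.faceFun_apply_of_mem _ _ _ _ _ _ _ h, map_zsmul,
      counitPiece_facePiece]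
  · rw [faceFunP_apply_of_not_mem _ _ _ _ _ _ _ h, CechOrd.faceFun_apply_of_not_mem _ _ _ _ _ _ _ h, map_zero]

variable {F} {G : X.Modules}

/-- **The presheaf differential is natural in the sheaf.** [cite: GortzWedhorn2023, Def. 21.68 (p. 260)] -/
theorem presheafMap_dP (φ : F ⟶ G) :
    presheafMap (faces U n) 0 φ ≫ dP U G n = dP U F n ≫ presheafMap (faces U (n + 1)) 0 φ := by
  ext V c
  refine funext fun γ => ?_
  change dFun U G n V.unop (fun α => mapPiece (faces U n) 0 φ V.unop α (c α)) γ =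
    mapPiece (faces U (n + 1)) 0 φ V.unop γ (dFun U F n V.unop c γ)
  rw [dFun_apply, dFun_apply, map_sum]
  refine Finset.sum_congr rfl fun a _ => ?_
  by_cases h : a ∈ (γ 0).1
  · rw [faceFunP_apply_of_mem _ _ _ _ _ _ _ h, faceFunP_apply_of_mem _ _ _ _ _ _ _ h, map_zsmul,
      mapPiece_facePiece]
  · rw [faceFunP_apply_of_not_mem _ _ _ _ _ _ _ h, faceFunP_apply_of_not_mem _ _ _ _ _ _ _ h, map_zero]

/-- **`P̌•_ord(𝓤, φ)`** at presheaf level. [cite: GortzWedhorn2023, Def. 21.68 (p. 260)] -/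
def precomplexMap (φ : F ⟶ G) : precomplex U F ⟶ precomplex U G :=
  CochainComplex.ofHom (fun n => presheafMap (faces U n) 0 φ) fun n => by
    rw [precomplex_d, precomplex_d]
    exact presheafMap_dP U n φ

/-! ## §3 The sheafified complex `P̌•_ord(𝓤, F)` and its counit to `Č•_ord(𝓤, F)` -/

section Sheaf

variable (F)

/-- **The ordered complex of localized-sections sheaves `P̌•_ord(𝓤, F)`**: the precomplex sheafified termwise
(`modulesSheafify` is a left adjoint, hence preserves zero morphisms). [cite: GortzWedhorn2023, Def. 21.68 (p. 260)]
[cite: StacksProject, Tag 08D6] -/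
def complex : CochainComplex X.Modules ℕ :=
  ((modulesSheafify X).mapHomologicalComplex (ComplexShape.up ℕ)).obj (precomplex U F)

/-- The terms of `P̌•_ord(𝓤, F)` are the sheaves `PCech.obj (faces U n) 0 F` (definitional).
[cite: GortzWedhorn2023, Def. 21.68 (p. 260)] -/
theorem complex_X : (complex U F).X n = PCech.obj (faces U n) 0 F := rfl

/-- The differentials of `P̌•_ord(𝓤, F)` are the sheafified presheaf differentials. [cite: GortzWedhorn2023, Def. 21.68 (p. 260)] -/
theorem complex_d : (complex U F).d n (n + 1) = (modulesSheafify X).map (dP U F n) := by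
  change (modulesSheafify X).map ((precomplex U F).d n (n + 1)) = _
  rw [precomplex_d]

variable {F}

/-- **`P̌•_ord(𝓤, φ)`**: functoriality of the complex in the sheaf. [cite: GortzWedhorn2023, Def. 21.68 (p. 260)] -/
def complexMap (φ : F ⟶ G) : complex U F ⟶ complex U G :=
  ((modulesSheafify X).mapHomologicalComplex (ComplexShape.up ℕ)).map (precomplexMap U φ)

/-- Components of `P̌•_ord(𝓤, φ)` are `PCech.map`. [cite: GortzWedhorn2023, Def. 21.68 (p. 260)] -/
theorem complexMap_f (φ : F ⟶ G) : (complexMap U φ).f n = PCech.map (faces U n) 0 φ := rfl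

variable (F)

/-- **The counit chain map `P̌•_ord(𝓤, F) ⟶ Č•_ord(𝓤, F)`** (componentwise the counit `PCech.counit`, which
commutes with the differentials because the presheaf counit does, `dP_counitPresheaf`).
[cite: GortzWedhorn2023, Def. 21.68 (p. 260) and Lemma 22.36 (p. 349)] -/
def counitComplex : complex U F ⟶ CechOrd.complex U F where
  f n := PCech.counit (faces U n) 0 F
  comm' i j hij := by
    obtain rfl : i + 1 = j := hij
    rw [complex_d, CechOrd.complex_d]
    -- transpose along the sheafification adjunction
    apply ((modulesSheafifyAdjunction X).homEquiv (PCech.presheafMod (faces U i) 0 F) (CechOrd.obj U F (i + 1))).injective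
    rw [Adjunction.homEquiv_unit, Adjunction.homEquiv_unit, Functor.map_comp, Functor.map_comp]
    have hu := (modulesSheafifyAdjunction X).unit.naturality (dP U F i)
    change PCech.toObj (faces U i) 0 F ≫ _ ≫ _ = PCech.toObj (faces U i) 0 F ≫ _ ≫ _
    rw [← Category.assoc, PCech.toObj_counit, ← Category.assoc,
      show PCech.toObj (faces U i) 0 F ≫ (Scheme.Modules.toPresheafOfModules X).map ((modulesSheafify X).map (dP U F i)) =
        dP U F i ≫ PCech.toObj (faces U (i + 1)) 0 F from (hu).symm,
      Category.assoc, PCech.toObj_counit]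
    exact (dP_counitPresheaf U F i).symm

/-- Components of the counit chain map. [cite: GortzWedhorn2023, Lemma 22.36 (p. 349)] -/
theorem counitComplex_f : (counitComplex U F).f n = PCech.counit (faces U n) 0 F := rfl

variable {F}

/-- **The counit chain map is natural in the sheaf.** [cite: GortzWedhorn2023, Lemma 22.36 (p. 349)] -/
theorem complexMap_counitComplex (φ : F ⟶ G) :
    complexMap U φ ≫ counitComplex U G = counitComplex U F ≫ CechOrd.complexMap U φ := by
  ext n : 1
  rw [HomologicalComplex.comp_f, HomologicalComplex.comp_f, complexMap_f, counitComplex_f, counitComplex_f,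
    CechOrd.complexMap_f, PCech.map_counit]

end Sheaf

end PCechOrd

end Literature.AlgebraicGeometry.Modules

end
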